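/-
Copyright: H21 programme, solo seat `solo-RiemannHypothesis-informed` (session 6).
-/
import Summits.RiemannHypothesis.RiemannHypothesis.Theorems.SoloInformedCompanionPrice

/-!
# The price of a companion with a free Turán interval (solo-informed, T39♯)

`companion_window` (T39) runs Turán's theorem on the unit interval `[2a-3, 2a-2]` and so pays
`log(250(2a-2))` per companion.  Turán's lower bound is scale-invariant: on `[τ₀, τ₀+ℓ]` the
constant is `c(n, τ₀/ℓ)` (`exists_norm_expSum_ge_of_weights_scaled`, by rescaling the nodes
`λ ↦ ℓλ`).  Running the assembly of T39 on `[2a-2-ℓ, 2a-2]` gives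

**T39♯** (`companion_window_scaled`).  Under the hypotheses of T39 with (K1) stated for
`c(M+1, (2a-2-ℓ)/ℓ)`, `0 < ℓ ≤ 2a-4`:

`η (2a-2-ℓ) ≤ log(10π A₁ C_χ² (2J_M+1) L_M) + (M+1) + (M+2) log(250 (2a-2)/ℓ)`.

With `ℓ = (2a-2)/(k+1)` the gain is the fraction `k/(k+1)` of the window and each companion
costs the CONSTANT `log(250(k+1)) + 1` — no `log a`.  So the tariff of T39 in window units is
`min_k ((k+1)/k)·(log(250(k+1)) + 1) ≈ 9.8` per companion (k ≈ 8), against `log(500a) + 1`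
growing with `a` for `ℓ = 1`; Turán's `k^{-n}` shape is sharp (binomial sums
`(1 + e^{iπτ/τ₀})^{n-1}` are `≤ (π/k)^{n-1}` on `[τ₀, τ₀ + τ₀/k]`), so within this method the
price of a companion is a constant number of window units and no less.
-/

noncomputable section

open Real MeasureTheory Filter Complex Set Literature.NumberTheory.LFunctions
open scoped Topology ContDiff ComplexConjugate

namespace Summit.RiemannHypothesis.RiemannHypothesis.Theorems

open Companion

/-- **Turán visibility on a scaled interval.**  On `[τ₀, τ₀ + ℓ]` the constant of
`exists_norm_expSum_ge_of_weights` is `c(n, τ₀/ℓ)` (rescale the nodes by `ℓ`). -/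
theorem exists_norm_expSum_ge_of_weights_scaled {ι : Type*} (s : Finset ι) (lam : ι → ℂ)
    (b : ι → ℝ) (hb : ∀ j ∈ s, 0 ≤ b j) {j₀ : ι} (hj₀ : j₀ ∈ s)
    (hmax : ∀ j ∈ s, (lam j).re ≤ (lam j₀).re) {τ₀ ℓ : ℝ} (hτ₀ : 0 ≤ τ₀) (hℓ : 0 < ℓ)
    (w : ι → ℂ) {ε : ℝ} (hw : ∀ j ∈ s, ‖w j - 1‖ ≤ ε) :
    ∃ τ ∈ Set.Icc τ₀ (τ₀ + ℓ),
      (b j₀ * turanConst s.card (τ₀ / ℓ) - ε * ∑ j ∈ s, b j) * Real.exp ((lam j₀).re * τ) ≤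
        ‖∑ j ∈ s, (b j : ℂ) * w j * cexp (lam j * τ)‖ := by
  have hre : ∀ j, (lam j * ℓ).re = (lam j).re * ℓ := fun j ↦ by simp [Complex.mul_re]
  have hmax' : ∀ j ∈ s, (lam j * ℓ).re ≤ (lam j₀ * ℓ).re := fun j hj ↦ by
    rw [hre, hre]; exact mul_le_mul_of_nonneg_right (hmax j hj) hℓ.le
  obtain ⟨τ', hτ', hT⟩ := exists_norm_expSum_ge_of_weights s (fun j ↦ lam j * ℓ) b hb hj₀ hmax'
    (div_nonneg hτ₀ hℓ.le) w hw
  refine ⟨ℓ * τ', ⟨?_, ?_⟩, ?_⟩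
  · have := mul_le_mul_of_nonneg_left hτ'.1 hℓ.le
    rwa [mul_div_cancel₀ _ hℓ.ne'] at this
  · have := mul_le_mul_of_nonneg_left hτ'.2 hℓ.le
    rwa [mul_add, mul_div_cancel₀ _ hℓ.ne', mul_one] at this
  have e1 : (lam j₀ * ℓ).re * τ' = (lam j₀).re * (ℓ * τ') := by rw [hre]; ring
  have e2 : ∀ j, cexp (lam j * ℓ * τ') = cexp (lam j * ((ℓ * τ' : ℝ) : ℂ)) := fun j ↦ by
    push_cast; ring_nf
  rw [e1] at hT
  simp_rw [e2] at hT
  exact hT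

set_option maxHeartbeats 800000 in
/-- **T39♯ (the price of a companion, free Turán interval).**  See the module docstring. -/
theorem companion_window_scaled {η : ℝ} (hη : 0 < η) (M K q : ℕ) (hq : 2 ≤ q)
    (hK : 1 ≤ K) {a γ₀ ℓ : ℝ} (hℓ : 0 < ℓ) (hℓa : ℓ ≤ 2 * a - 4)
    (hγ : 2 * π * (M + 1) * K ≤ |γ₀|)
    (hK2 : Real.exp a * (2 * combL q / (π * K) ^ (q - 2)) ^ 2 ≤ combC ^ 2)
    (hε : 2 * combL q / (π ^ q * K ^ (q - 1)) ≤ 1 / 4)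
    (hK1 : 2 * (2 * combL q / (π ^ q * K ^ (q - 1))) *
        (4 * π * zetaDensityConst * combC ^ 2 * (2 * ((2 * M + 1) * K) + 1) *
          Real.log (|γ₀| + π * ((2 * M + 1) * K) + 2)) ≤
        turanConst (M + 1) ((2 * a - 2 - ℓ) / ℓ))
    (hcount : {ρ : ℂ | riemannZeta ρ = 0 ∧ 1 / 2 < ρ.re ∧
        |ρ.im - γ₀| < 2 * π * (M + 1) * K}.encard ≤ ((M + 1 : ℕ) : ℕ∞))
    (hE : 0 ≤ weilGroundEnergy a) (hζ : riemannZeta (1 / 2 + η + γ₀ * I) = 0) :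
    η * (2 * a - 2 - ℓ) ≤
      Real.log (10 * π * zetaDensityConst * combC ^ 2 * (2 * ((2 * M + 1) * K) + 1) *
          Real.log (|γ₀| + π * ((2 * M + 1) * K) + 2)) +
        (M + 1) + (M + 2) * Real.log (250 * ((2 * a - 2) / ℓ)) := by
  classical
  -- constants
  set A₁ : ℝ := zetaDensityConst
  have hA₁ : 0 < A₁ := zetaDensityConst_pos
  have hC := combC_nonneg
  set ε : ℝ := 2 * combL q / (π ^ q * K ^ (q - 1)) with hε_def
  have hε0 : 0 ≤ ε := by
    rw [hε_def]; exact div_nonneg (by linarith [combL_nonneg q]) (by positivity)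
  set JM : ℝ := (2 * M + 1) * K with hJM
  set LM : ℝ := Real.log (|γ₀| + π * JM + 2) with hLM
  set SM : ℝ := 4 * π * A₁ * combC ^ 2 * (2 * JM + 1) * LM with hSM
  set cT : ℝ := turanConst (M + 1) ((2 * a - 2 - ℓ) / ℓ) with hcT
  have hτ₀' : (0 : ℝ) ≤ 2 * a - 2 - ℓ := by linarith
  have hτ₀ : (0 : ℝ) ≤ (2 * a - 2 - ℓ) / ℓ := div_nonneg hτ₀' hℓ.le
  have hcT0 : 0 < cT := turanConst_pos _ hτ₀
  have hKr : (1 : ℝ) ≤ K := by exact_mod_cast hK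
  have hKpos : (0 : ℝ) < K := by linarith
  change 2 * ε * SM ≤ cT at hK1
  change η * (2 * a - 2 - ℓ) ≤ Real.log (10 * π * A₁ * combC ^ 2 * (2 * JM + 1) * LM) +
    (M + 1) + (M + 2) * Real.log (250 * ((2 * a - 2) / ℓ))
  -- the finite set of right-of-the-line zone zeros
  set Z : Set ℂ := {ρ : ℂ | riemannZeta ρ = 0 ∧ 1 / 2 < ρ.re ∧
    |ρ.im - γ₀| < 2 * π * (M + 1) * K} with hZ_def
  have hfin : Z.Finite := Set.finite_of_encard_le_coe hcount
  set Pmax : Finset ℂ := hfin.toFinset with hPmax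
  have hmemP : ∀ ρ, ρ ∈ Pmax ↔ riemannZeta ρ = 0 ∧ 1 / 2 < ρ.re ∧
      |ρ.im - γ₀| < 2 * π * (M + 1) * K := fun ρ ↦ by rw [hPmax, hfin.mem_toFinset]; rfl
  set ρ₀ : ℂ := 1 / 2 + η + γ₀ * I with hρ₀
  have hρ₀re : ρ₀.re = 1 / 2 + η := by simp [hρ₀]
  have hρ₀im : ρ₀.im = γ₀ := by simp [hρ₀]
  have hρ₀P : ρ₀ ∈ Pmax := by
    rw [hmemP]; refine ⟨hζ, by rw [hρ₀re]; linarith, ?_⟩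
    rw [hρ₀im, sub_self, abs_zero]; positivity
  have hcardP : Pmax.card ≤ M + 1 := by
    have h := hfin.encard_eq_coe_toFinset_card
    rw [h] at hcount
    exact_mod_cast hcount
  -- shell pigeonhole on the companions
  obtain ⟨i, hiM, hshell⟩ := exists_free_shell (Pmax.erase ρ₀) (M := M)
    (by rw [Finset.card_erase_of_mem hρ₀P]; omega) γ₀ hKpos
  have hiMr : (i : ℝ) ≤ M := by exact_mod_cast hiM
  set J : ℕ := (2 * i + 1) * K with hJ
  have hJr : (J : ℝ) = (2 * i + 1) * K := by rw [hJ]; push_cast; ring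
  have hKJ : K ≤ J := by rw [hJ]; exact Nat.le_mul_of_pos_left K (by omega)
  have hiK : (i : ℝ) * K ≤ M * K := mul_le_mul_of_nonneg_right hiMr hKpos.le
  have hJJM : (J : ℝ) ≤ JM := by rw [hJr, hJM]; linarith
  have hcore : ∀ ρ ∈ Pmax, |ρ.im - γ₀| < π * (J + K) → |ρ.im - γ₀| ≤ π * (J - K) := by
    intro ρ hρ hnear
    rw [hJr] at hnear ⊢
    by_cases h0 : ρ = ρ₀
    · rw [h0, hρ₀im, sub_self, abs_zero]
      have : (0 : ℝ) ≤ π * (2 * i * K) := by positivity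
      linarith
    · rcases hshell ρ (Finset.mem_erase.mpr ⟨h0, hρ⟩) with h | h
      · linarith
      · linarith
  -- the core set `P` and the zone of `J`
  have hPzone : π * ((J : ℝ) + K) ≤ 2 * π * (M + 1) * K := by
    rw [hJr]; have := mul_le_mul_of_nonneg_left hiK Real.pi_pos.le; linarith
  have hγJ : π * ((J : ℝ) + K) ≤ |γ₀| := hPzone.trans hγ
  set P : Finset ℂ := Pmax.filter (fun ρ ↦ |ρ.im - γ₀| < π * (J + K)) with hP_def
  have hmem : ∀ ρ, ρ ∈ P ↔ riemannZeta ρ = 0 ∧ 1 / 2 < ρ.re ∧ |ρ.im - γ₀| < π * (J + K) := by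
    intro ρ
    rw [hP_def, Finset.mem_filter, hmemP]
    constructor
    · rintro ⟨⟨hz, hre, -⟩, hnear⟩; exact ⟨hz, hre, hnear⟩
    · rintro ⟨hz, hre, hnear⟩; exact ⟨⟨hz, hre, by linarith⟩, hnear⟩
  have hρ₀mem : ρ₀ ∈ P := by
    rw [hmem]; refine ⟨hζ, by rw [hρ₀re]; linarith, ?_⟩
    rw [hρ₀im, sub_self, abs_zero]; positivity
  have hPsub : P ⊆ Pmax := Finset.filter_subset _ _
  have hP : ∀ ρ ∈ P, riemannZeta ρ = 0 ∧ 1 / 2 < ρ.re ∧ |ρ.im - γ₀| < π * (J + K) :=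
    fun ρ hρ ↦ (hmem ρ).mp hρ
  have hP' : ∀ ρ ∈ P, riemannZeta ρ = 0 ∧ 1 / 2 < ρ.re ∧ ρ.re < 1 ∧ ρ.im ≠ 0 := by
    intro ρ hρ
    obtain ⟨hz, hre, hnear⟩ := hP ρ hρ
    refine ⟨hz, hre, re_lt_one_of_riemannZeta_eq_zero hz, ?_⟩
    intro h0; rw [h0, zero_sub, abs_neg] at hnear; linarith
  have hcomp := zone_complete hγJ hmem
  -- T39g: Weil positivity bounds the core exponential sum
  set Λ : ℂ → ℂ := fun ρ ↦ ρ - 1 / 2 - γ₀ * I with hΛ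
  set Φ : ℂ → ℂ := fun ρ ↦ combXform J (Λ ρ) with hΦ
  set m : ℂ → ℝ := fun ρ ↦ (riemannZetaZeroOrder ρ : ℝ) with hm
  set L : ℝ := Real.log (|γ₀| + π * J + 2) with hL
  have hUle : ∀ τ : ℝ, 2 ≤ τ → τ ≤ 2 * a - 2 →
      ‖∑ ρ ∈ P, (m ρ : ℂ) * (Φ ρ ^ 2 * cexp (Λ ρ * τ))‖ ≤
        20 * π * A₁ * combC ^ 2 * (2 * J + 1) * L := fun τ h1 h2 ↦
    norm_combExpSum_le hq hK (by linarith) hγJ hK2 P hP hcomp hE h1 h2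
  -- flatness on the core
  have hflat : ∀ ρ ∈ P, ‖Φ ρ - 2‖ ≤ ε := by
    intro ρ hρ
    obtain ⟨_, hre, h1, _⟩ := hP' ρ hρ
    have hc := hcore ρ (hPsub hρ) (hP ρ hρ).2.2
    refine norm_combXform_sub_two_le hq hK hKJ ?_ ?_
    · rw [show (Λ ρ).re = ρ.re - 1 / 2 by simp [hΛ], abs_le]; constructor <;> linarith
    · rw [show (Λ ρ).im = ρ.im - γ₀ by simp [hΛ]]; exact hc
  have hmult : ∀ ρ ∈ P, Φ ρ ≠ 0 ∧ 3 ≤ ‖Φ ρ‖ ^ 2 ∧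
      ‖Φ ρ ^ 2 / ((‖Φ ρ‖ ^ 2 : ℝ) : ℂ) - 1‖ ≤ 2 * ε := fun ρ hρ ↦
    flat_multiplier (hflat ρ hρ) hε
  -- the size of the weights
  have hS : ∑ ρ ∈ P, m ρ * ‖Φ ρ‖ ^ 2 ≤ 4 * π * A₁ * combC ^ 2 * (2 * J + 1) * L :=
    sum_norm_sq_combXform_le γ₀ J P fun ρ hρ ↦
      ⟨(hP' ρ hρ).1, by linarith [(hP' ρ hρ).2.1], (hP' ρ hρ).2.2.1.le, (hP' ρ hρ).2.2.2⟩
  -- monotonicity `J ≤ J_M`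
  have hL0 : 0 < L := Real.log_pos (by nlinarith [abs_nonneg γ₀, Real.pi_pos, (Nat.cast_nonneg J : (0:ℝ) ≤ J)])
  have hLLM : L ≤ LM := Real.log_le_log (by positivity) (by nlinarith [Real.pi_pos])
  have hmono : (2 * (J : ℝ) + 1) * L ≤ (2 * JM + 1) * LM :=
    mul_le_mul (by linarith) hLLM hL0.le (by nlinarith)
  have hSSM : ∑ ρ ∈ P, m ρ * ‖Φ ρ‖ ^ 2 ≤ SM := by
    refine hS.trans ?_
    have : 0 ≤ 4 * π * A₁ * combC ^ 2 := by positivity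
    calc 4 * π * A₁ * combC ^ 2 * (2 * J + 1) * L = 4 * π * A₁ * combC ^ 2 * ((2 * J + 1) * L) := by
          ring
      _ ≤ 4 * π * A₁ * combC ^ 2 * ((2 * JM + 1) * LM) := by gcongr
      _ = SM := by rw [hSM]; ring
  -- Turán visibility on the core
  obtain ⟨j₀, hj₀, hmax⟩ := Finset.exists_max_image P (fun ρ ↦ ρ.re) ⟨ρ₀, hρ₀mem⟩
  set b : ℂ → ℝ := fun ρ ↦ m ρ * ‖Φ ρ‖ ^ 2 with hb
  set w : ℂ → ℂ := fun ρ ↦ Φ ρ ^ 2 / ((‖Φ ρ‖ ^ 2 : ℝ) : ℂ) with hw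
  have hm0 : ∀ ρ ∈ P, 0 ≤ m ρ := fun ρ hρ ↦ riemannZetaZeroOrder_nonneg_of_zero (hP ρ hρ).1
  have hb0 : ∀ ρ ∈ P, 0 ≤ b ρ := fun ρ hρ ↦ mul_nonneg (hm0 ρ hρ) (by positivity)
  have hmax' : ∀ ρ ∈ P, (Λ ρ).re ≤ (Λ j₀).re := by
    intro ρ hρ
    simp only [hΛ, sub_re]
    linarith [hmax ρ hρ]
  obtain ⟨τ, hτ, hT⟩ := exists_norm_expSum_ge_of_weights_scaled P Λ b hb0 hj₀ hmax' hτ₀' hℓ w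
    (fun ρ hρ ↦ (hmult ρ hρ).2.2)
  -- identify the Turán sum with `U(τ)`
  have hident : ∑ ρ ∈ P, (b ρ : ℂ) * w ρ * cexp (Λ ρ * τ) =
      ∑ ρ ∈ P, (m ρ : ℂ) * (Φ ρ ^ 2 * cexp (Λ ρ * τ)) := by
    refine Finset.sum_congr rfl fun ρ hρ ↦ ?_
    have h2 : (((‖Φ ρ‖ ^ 2 : ℝ)) : ℂ) ≠ 0 := by
      exact_mod_cast (pow_pos (norm_pos_iff.mpr (hmult ρ hρ).1) 2).ne'
    simp only [hb, hw, Complex.ofReal_mul]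
    rw [mul_assoc (m ρ : ℂ), mul_div_assoc', mul_div_cancel_left₀ _ h2, mul_assoc]
  rw [hident] at hT
  have hτ1 : 2 ≤ τ := by linarith [hτ.1]
  have hτ2 : τ ≤ 2 * a - 2 := by linarith [hτ.2]
  have hkey := hT.trans (hUle τ hτ1 hτ2)
  -- lower bound of the Turán coefficient
  have hcard : P.card ≤ M + 1 := (Finset.card_le_card hPsub).trans hcardP
  have hcn : cT ≤ turanConst P.card ((2 * a - 2 - ℓ) / ℓ) := turanConst_anti hcard hτ₀
  have hbj₀ : 3 ≤ b j₀ := by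
    have hz := (hP j₀ hj₀).1
    have hm1 : (1 : ℝ) ≤ m j₀ := by
      have := (riemannZetaZeroOrder_pos_iff (ne_one_of_riemannZeta_eq_zero hz)).mpr hz
      simp only [hm]; exact_mod_cast this
    have := (hmult j₀ hj₀).2.1
    simp only [hb]; nlinarith
  have hcoef : 2 * cT ≤ b j₀ * turanConst P.card ((2 * a - 2 - ℓ) / ℓ) -
      2 * ε * ∑ ρ ∈ P, b ρ := by
    have h1 : 3 * cT ≤ b j₀ * turanConst P.card ((2 * a - 2 - ℓ) / ℓ) :=
      mul_le_mul hbj₀ hcn hcT0.le (by linarith)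
    have h2 : 2 * ε * ∑ ρ ∈ P, b ρ ≤ cT := by
      refine le_trans ?_ hK1
      exact mul_le_mul_of_nonneg_left hSSM (by positivity)
    linarith
  have hexpη : Real.exp (η * (2 * a - 2 - ℓ)) ≤ Real.exp ((Λ j₀).re * τ) := by
    rw [Real.exp_le_exp]
    have h1 : η ≤ (Λ j₀).re := by
      have := hmax ρ₀ hρ₀mem
      simp only [hΛ, sub_re, Complex.mul_re, Complex.I_re, Complex.I_im, Complex.ofReal_re,
        Complex.ofReal_im]
      rw [hρ₀re] at this
      norm_num; linarith
    have h0 : 0 ≤ (Λ j₀).re := hη.le.trans h1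
    calc η * (2 * a - 2 - ℓ) ≤ (Λ j₀).re * (2 * a - 2 - ℓ) := by nlinarith
      _ ≤ (Λ j₀).re * τ := mul_le_mul_of_nonneg_left hτ.1 h0
  have hfinal : 2 * cT * Real.exp (η * (2 * a - 2 - ℓ)) ≤
      20 * π * A₁ * combC ^ 2 * (2 * JM + 1) * LM := by
    have h20 : 20 * π * A₁ * combC ^ 2 * (2 * J + 1) * L ≤
        20 * π * A₁ * combC ^ 2 * (2 * JM + 1) * LM := by
      have : 0 ≤ 20 * π * A₁ * combC ^ 2 := by positivity
      calc 20 * π * A₁ * combC ^ 2 * (2 * J + 1) * L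
          = 20 * π * A₁ * combC ^ 2 * ((2 * J + 1) * L) := by ring
        _ ≤ 20 * π * A₁ * combC ^ 2 * ((2 * JM + 1) * LM) := by gcongr
        _ = _ := by ring
    calc 2 * cT * Real.exp (η * (2 * a - 2 - ℓ))
        ≤ (b j₀ * turanConst P.card ((2 * a - 2 - ℓ) / ℓ) - 2 * ε * ∑ ρ ∈ P, b ρ) *
            Real.exp ((Λ j₀).re * τ) :=
          mul_le_mul hcoef hexpη (Real.exp_pos _).le (by linarith)
      _ ≤ _ := hkey.trans h20
  -- take logarithms
  set B10 : ℝ := 10 * π * A₁ * combC ^ 2 * (2 * JM + 1) * LM with hB10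
  have hexple : Real.exp (η * (2 * a - 2 - ℓ)) ≤ B10 / cT := by
    rw [le_div_iff₀ hcT0]; linarith
  rcases le_or_gt B10 0 with hB | hB
  · exfalso
    have : B10 / cT ≤ 0 := div_nonpos_of_nonpos_of_nonneg hB hcT0.le
    linarith [Real.exp_pos (η * (2 * a - 2 - ℓ))]
  have hlog := Real.log_le_log (Real.exp_pos _) hexple
  rw [Real.log_exp, Real.log_div hB.ne' hcT0.ne', hcT, log_turanConst _ hτ₀] at hlog
  have e : ((2 * a - 2 - ℓ) / ℓ + 1 : ℝ) = (2 * a - 2) / ℓ := by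
    field_simp; ring
  rw [e] at hlog
  push_cast at hlog
  linarith

end Summit.RiemannHypothesis.RiemannHypothesis.Theorems
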